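import Summits.Ventures.Crystal3D.StickySpheres.FourteenVertexConesBlocks
import Summits.Ventures.Crystal3D.StickySpheres.ContactNineFinal
import Summits.Ventures.Crystal3D.Bulk.ThirteenSphereMaximisers
import HarnessLib

/-!
# The eight 36-contact 13-clusters as a complete-list hypothesis; what it gives for kissing shells

Venture `Crystal3D` (cell `pub-crystal3d`, seat p1). The cell's census statement «`S_13(36)` = exactly the eight [HC16]
36-contact 13-clusters» (`MAXIMISERS-13.md` §0.1 (i): two independent chain codes on the same custody-checked superset base,
referee-signed at the grade "E1 single-decider base lists", `ref/MAX13-CHECK.md` §8) says: every relaxed-realisable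
13-vertex graph with `36` edges (and minimum degree `≥ 3`, which is automatic for packings since `C(12) = 33`) is isomorphic to
the contact graph of one of the eight clusters g1–g8. This file spells that statement as the hypothesis
`CompleteListHypothesis 3 36 13 (tableSet 13 HC13rows)` (eight row tables `HC13rows`: g1, g2, g3 here; g4–g8 = rows
`2, 1, 0, 3, 5` of `L36d4rows`), proves it is not vacuous (all eight rows ARE relaxed-realisable: they are the contact graphs of the kernel
packings `hc13g1Int … hc13g8Int` of `Bulk/ThirteenSphereMaximisers.lean`, identity labelling), and derives the GRAPH FORM of
the coordinator's question (iii) on centred 12-neighbour environments (`MAXIMISERS-13.md` §0.1 (iii-bis)):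

* `shellContacts_le_twentyfour`: if a ball touches 12 others then the 12 have at most `24` contacts among themselves —
  from `C(13) ≤ 36` alone (hypothesis `maxContacts 3 13 ≤ 36`, a tree theorem modulo the census lists);
* `iso_hc13_of_numContacts_eq`: under `C(12) ≤ 33` and that hypothesis, the contact graph of EVERY 36-contact packing
  of 13 balls is one of the eight tables;
* `iso_closePackedShell_of_coordination_twelve`: if moreover some ball has coordination `12` (equivalently the shell has
  exactly `24` internal contacts), the contact graph is that of g7 (centred anticuboctahedron, the hcp shell) or of g8
  (centred cuboctahedron, the fcc shell) — the six other tables have maximum degree `≤ 10` (kernel check).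

HONEST FRAMING: the eight-table completeness is a HYPOTHESIS (a census statement of the cell, not a kernel fact); `C(12) ≤ 33` /
`C(13) ≤ 36` are taken as hypotheses too (tree theorems modulo the lists `L21d4`, `L(10,25)`, `L(10,24)`, …, see
`ContactNineFinal.lean`, `ThirteenVertexConesCarried.lean`). The conclusions are about contact GRAPHS; congruence of the shell
to the fcc/hcp kissing arrangement is not claimed here. Standard axioms; `decide` for the finite checks.
-/

namespace Summit.Ventures.Crystal3D

open Finset SimpleGraph
open Literature.Geometry.DiscreteGeometry (sqNormInt)

/-! ### 1. The eight tables and the hypothesis -/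

/-- Row bitmasks of the three [HC16] 36-contact 13-clusters with a ball of coordination `3`: g1 `LCDI@Wachrk|vf`, g2
`L?Ogwb@gYvEzzN`, g3 `L?Og}A`cZZJZLn` (graph6 canonical vertex order of the cell's `step0/max13/ground13.json` = the label
order of `hc13g1Int`, `hc13g2Int`, `hc13g3Int`). [folklore] -/
def HC13d3rows : List (List ℕ) :=
  [[4616, 6240, 3456, 5649, 5288, 6290, 6914, 3124, 3652, 5449, 7068, 5606, 3707],
   [4864, 5392, 6688, 3264, 5218, 6228, 3128, 3848, 5763, 6533, 6618, 5868, 3895],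
   [896, 3216, 5408, 6720, 3170, 5204, 6200, 3843, 5765, 6537, 6582, 5850, 3948]]

/-- The eight row tables of the [HC16] 36-contact 13-clusters in the order g1, …, g8: g1–g3 from `HC13d3rows`, g4–g8 =
rows `2, 1, 0, 3, 5` of `L36d4rows` (`FourteenVertexConesBlocks.lean`). [folklore] -/
def HC13rows : List (List ℕ) :=
  HC13d3rows ++ [L36d4rows.getD 2 [], L36d4rows.getD 1 [], L36d4rows.getD 0 [], L36d4rows.getD 3 [], L36d4rows.getD 5 []]

-- «`S_13(36)` = the eight» as a complete-list hypothesis is written `CompleteListHypothesis 3 36 13 (tableSet 13 HC13rows)`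
-- below (every relaxed-realisable 13-vertex graph with 36 edges and minimum degree ≥ 3 is isomorphic to one of the eight
-- tables): the cell's census statement, a HYPOTHESIS of the theorems of §3, not proved anywhere in the tree.

/-! ### 2. Non-vacuity: the eight rows are the contact graphs of the kernel packings `hc13gkInt` -/

/-- Table `0` (g1) is realised by `hc13g1Int` (contacts at integer squared distance `162`). [folklore] -/
theorem relaxedRealisable_HC13rows_0 : RelaxedRealisable (tableGraph 13 (HC13rows.getD 0 [])) := by
  rw [tableGraph_eq (by decide +kernel) (by decide +kernel)]
  exact relaxedRealisable_boolGraph_of_intConfig _ _ _ hc13g1Int (m := 162) (by norm_num) (by decide +kernel) sep_hc13g1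

/-- Table `1` (g2) is realised by `hc13g2Int` (squared distance `18`). [folklore] -/
theorem relaxedRealisable_HC13rows_1 : RelaxedRealisable (tableGraph 13 (HC13rows.getD 1 [])) := by
  rw [tableGraph_eq (by decide +kernel) (by decide +kernel)]
  exact relaxedRealisable_boolGraph_of_intConfig _ _ _ hc13g2Int (m := 18) (by norm_num) (by decide +kernel) sep_hc13g2

/-- Table `2` (g3) is realised by `hc13g3Int` (squared distance `18`). [folklore] -/
theorem relaxedRealisable_HC13rows_2 : RelaxedRealisable (tableGraph 13 (HC13rows.getD 2 [])) := by
  rw [tableGraph_eq (by decide +kernel) (by decide +kernel)]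
  exact relaxedRealisable_boolGraph_of_intConfig _ _ _ hc13g3Int (m := 18) (by norm_num) (by decide +kernel) sep_hc13g3

/-- Table `3` (g4) is realised by `hc13g4Int` (squared distance `1458`). [folklore] -/
theorem relaxedRealisable_HC13rows_3 : RelaxedRealisable (tableGraph 13 (HC13rows.getD 3 [])) := by
  rw [tableGraph_eq (by decide +kernel) (by decide +kernel)]
  exact relaxedRealisable_boolGraph_of_intConfig _ _ _ hc13g4Int (m := 1458) (by norm_num) (by decide +kernel)
    sep_hc13g4

/-- Table `4` (g5) is realised by `hc13g5Int` (squared distance `2`). [folklore] -/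
theorem relaxedRealisable_HC13rows_4 : RelaxedRealisable (tableGraph 13 (HC13rows.getD 4 [])) := by
  rw [tableGraph_eq (by decide +kernel) (by decide +kernel)]
  exact relaxedRealisable_boolGraph_of_intConfig _ _ _ hc13g5Int (m := 2) (by norm_num) (by decide +kernel) sep_hc13g5

/-- Table `5` (g6) is realised by `hc13g6Int` (squared distance `162`). [folklore] -/
theorem relaxedRealisable_HC13rows_5 : RelaxedRealisable (tableGraph 13 (HC13rows.getD 5 [])) := by
  rw [tableGraph_eq (by decide +kernel) (by decide +kernel)]
  exact relaxedRealisable_boolGraph_of_intConfig _ _ _ hc13g6Int (m := 162) (by norm_num) (by decide +kernel) sep_hc13g6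

/-- Table `6` (g7, centred anticuboctahedron) is realised by `hc13g7Int` (squared distance `18`). [folklore] -/
theorem relaxedRealisable_HC13rows_6 : RelaxedRealisable (tableGraph 13 (HC13rows.getD 6 [])) := by
  rw [tableGraph_eq (by decide +kernel) (by decide +kernel)]
  exact relaxedRealisable_boolGraph_of_intConfig _ _ _ hc13g7Int (m := 18) (by norm_num) (by decide +kernel) sep_hc13g7

/-- Table `7` (g8, centred cuboctahedron) is realised by `hc13g8Int` (squared distance `18`). [folklore] -/
theorem relaxedRealisable_HC13rows_7 : RelaxedRealisable (tableGraph 13 (HC13rows.getD 7 [])) := by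
  rw [tableGraph_eq (by decide +kernel) (by decide +kernel)]
  exact relaxedRealisable_boolGraph_of_intConfig _ _ _ hc13g8Int (m := 18) (by norm_num) (by decide +kernel) sep_hc13g8

/-- **Non-vacuity:** every one of the eight tables is relaxed-realisable. [folklore] -/
theorem relaxedRealisable_HC13rows {k : ℕ} (hk : k < 8) : RelaxedRealisable (tableGraph 13 (HC13rows.getD k [])) := by
  interval_cases k
  · exact relaxedRealisable_HC13rows_0
  · exact relaxedRealisable_HC13rows_1
  · exact relaxedRealisable_HC13rows_2
  · exact relaxedRealisable_HC13rows_3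
  · exact relaxedRealisable_HC13rows_4
  · exact relaxedRealisable_HC13rows_5
  · exact relaxedRealisable_HC13rows_6
  · exact relaxedRealisable_HC13rows_7

/-! ### 3. Contact graphs of packings with 36 contacts -/

/-- In a packing of 13 balls with `≥ 36` contacts every ball has coordination `≥ 3`, provided `C(12) ≤ 33` (removing a
ball with `≤ 2` contacts would leave `≥ 34` contacts among 12 balls). [folklore] -/
theorem three_le_coordination_of_numContacts_ge (h12 : maxContacts 3 12 ≤ 33)
    {x : Fin 13 → EuclideanSpace ℝ (Fin 3)} (hx : IsUnitPacking x) (h36 : 36 ≤ numContacts x) (i : Fin 13) :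
    3 ≤ coordination x i := by
  by_contra h
  have h2 : coordination x i ≤ 2 := by omega
  have h3 := numContacts_le_add_maxContacts hx h2
  omega

/-- **If a ball touches 12 others, those 12 have at most `24` contacts among themselves** — from `C(13) ≤ 36` (the
contacts of the 13 balls are the 12 spokes plus the shell's own). [folklore] -/
theorem shellContacts_le_twentyfour (h13 : maxContacts 3 13 ≤ 36) {x : Fin 13 → EuclideanSpace ℝ (Fin 3)}
    (hx : IsUnitPacking x) {i₀ : Fin 13} (hi : coordination x i₀ = 12) : numContacts (x ∘ i₀.succAbove) ≤ 24 := by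
  have h1 := numContacts_eq_coordination_add x i₀
  have h2 := numContacts_le_maxContacts hx (d := 3)
  omega

/-- Degrees of a valid table graph are bounded by a bound on its row counts (whatever the instances). [folklore] -/
theorem degree_tableGraph_le {m D : ℕ} (rows : List ℕ) (hs : symmB (adjOfRows rows : Fin m → Fin m → Bool) = true)
    (hl : irreflB (adjOfRows rows : Fin m → Fin m → Bool) = true)
    (hD : ∀ v : Fin m, rowDeg (adjOfRows rows : Fin m → Fin m → Bool) v ≤ D) (v : Fin m)
    [Fintype ((tableGraph m rows).neighborSet v)] : (tableGraph m rows).degree v ≤ D := by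
  rw [degree_congr_of_eq (tableGraph_eq hs hl) v, degree_boolGraph']
  exact hD v

/-- **Every 36-contact packing of 13 balls has one of the eight contact graphs** (under `C(12) ≤ 33` and the list
hypothesis): the graph on the labels whose edges are the contact pairs is isomorphic to one of the tables `HC13rows`.
[folklore] -/
theorem iso_hc13_of_numContacts_eq (h12 : maxContacts 3 12 ≤ 33) (hS : CompleteListHypothesis 3 36 13 (tableSet 13 HC13rows))
    {x : Fin 13 → EuclideanSpace ℝ (Fin 3)} (hx : IsUnitPacking x) (h36 : numContacts x = 36) :
    ∃ k, k < 8 ∧ Nonempty (pairGraph (contactPairs x) ≃g tableGraph 13 (HC13rows.getD k [])) := by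
  classical
  have hT : ∀ p ∈ contactPairs x, p.1 < p.2 := fun p hp => ((mem_contactPairs x).1 hp).1
  have hcard : (pairGraph (contactPairs x)).edgeFinset.card = 36 := by
    rw [card_edgeFinset_pairGraph hT]
    exact h36
  have hmin : ∀ i, 3 ≤ (pairGraph (contactPairs x)).degree i := fun i =>
    (three_le_coordination_of_numContacts_ge h12 hx h36.ge i).trans
      ((card_contactPairs_filter_mem x i).symm.le.trans (card_filter_le_degree_pairGraph hT i))
  have hRR : RelaxedRealisable (pairGraph (contactPairs x)) := by
    refine ⟨x, fun i j hij => ?_, fun i j hij => hx.one_le_dist hij⟩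
    rcases (pairGraph_adj hT).1 hij with h | h
    · exact ((mem_contactPairs x).1 h).2
    · rw [dist_comm]; exact ((mem_contactPairs x).1 h).2
  obtain ⟨H, ⟨k, hk, rfl⟩, hiso⟩ := hS (pairGraph (contactPairs x)) hcard hmin hRR
  exact ⟨k, by simpa [HC13rows, HC13d3rows] using hk, hiso⟩

/-- **Graph form of the coordinator's question (iii):** under `C(12) ≤ 33` and the list hypothesis, a 36-contact packing
of 13 balls in which some ball touches the 12 others — i.e. a kissing shell with exactly `24` internal contacts — has the
contact graph of g7 (centred anticuboctahedron = hcp shell, `L36d4rows` row `3`) or of g8 (centred cuboctahedron = fcc shell,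
row `5`): the other six tables have maximum degree `≤ 10`. [folklore] -/
theorem iso_closePackedShell_of_coordination_twelve (h12 : maxContacts 3 12 ≤ 33) (hS : CompleteListHypothesis 3 36 13 (tableSet 13 HC13rows))
    {x : Fin 13 → EuclideanSpace ℝ (Fin 3)} (hx : IsUnitPacking x) (h36 : numContacts x = 36) {i₀ : Fin 13}
    (hi : coordination x i₀ = 12) :
    Nonempty (pairGraph (contactPairs x) ≃g tableGraph 13 (L36d4rows.getD 3 [])) ∨
      Nonempty (pairGraph (contactPairs x) ≃g tableGraph 13 (L36d4rows.getD 5 [])) := by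
  classical
  have hT : ∀ p ∈ contactPairs x, p.1 < p.2 := fun p hp => ((mem_contactPairs x).1 hp).1
  have hdeg : 12 ≤ (pairGraph (contactPairs x)).degree i₀ :=
    hi.ge.trans ((card_contactPairs_filter_mem x i₀).symm.le.trans (card_filter_le_degree_pairGraph hT i₀))
  obtain ⟨k, hk, ⟨φ⟩⟩ := iso_hc13_of_numContacts_eq h12 hS hx h36
  have h12' : 12 ≤ (tableGraph 13 (HC13rows.getD k [])).degree (φ i₀) := by
    rw [φ.degree_eq]
    exact hdeg
  interval_cases k
  · exact absurd (degree_tableGraph_le (m := 13) (HC13rows.getD 0 []) (by decide +kernel) (by decide +kernel)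
      (D := 10) (by decide +kernel) (φ i₀)) (by omega)
  · exact absurd (degree_tableGraph_le (m := 13) (HC13rows.getD 1 []) (by decide +kernel) (by decide +kernel)
      (D := 10) (by decide +kernel) (φ i₀)) (by omega)
  · exact absurd (degree_tableGraph_le (m := 13) (HC13rows.getD 2 []) (by decide +kernel) (by decide +kernel)
      (D := 10) (by decide +kernel) (φ i₀)) (by omega)
  · exact absurd (degree_tableGraph_le (m := 13) (HC13rows.getD 3 []) (by decide +kernel) (by decide +kernel)
      (D := 10) (by decide +kernel) (φ i₀)) (by omega)
  · exact absurd (degree_tableGraph_le (m := 13) (HC13rows.getD 4 []) (by decide +kernel) (by decide +kernel)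
      (D := 10) (by decide +kernel) (φ i₀)) (by omega)
  · exact absurd (degree_tableGraph_le (m := 13) (HC13rows.getD 5 []) (by decide +kernel) (by decide +kernel)
      (D := 10) (by decide +kernel) (φ i₀)) (by omega)
  · exact Or.inl ⟨φ⟩
  · exact Or.inr ⟨φ⟩

end Summit.Ventures.Crystal3D
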